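import Summits.CriticalPhenomena.PercolationContinuityZ3.Theorems.PercNearOneGluingNoHeavyQuantDECAtTMixtures
import Summits.CriticalPhenomena.PercolationContinuityZ3.Theorems.PercNearOneGluingNoHeavyQuantBlobDecTwoLaw
import Summits.CriticalPhenomena.PercolationContinuityZ3.Theorems.PercNearOneGluingNoHeavyQuantSliceSmallLayers
import HarnessLib

/-!
# QUANT lane R8, T-DEC: CONJECTURE SL HOLDS FOR HEAVY DECOMPOSITIONS — the slice of a law whose layer-`j′` decomposition has no
# light credit pair is DEC(j′), with ONE hypothesis (layer `j′` only) and at the CREDIT target `T + a·g`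

builds on p205010 (kernel theorem, internal audit signed; external expert review pending)

Statement + support file (`--supports stmt-CriticalPhenomena-4575`), QUANT lane typer seat prim-quant-stmt (gen 22), rung R8 of
`run/shared/lean/prim/quant/LADDER.md`.  Two small definitions (`LawDec.HValidAt`, `LawDec.HDECAtT` = `ValidAt`/`DECAtT` without the
light branch of rule (N)), theorems with standard axioms, no sorries.  Uses census-2 g51/g52's BLOB-DEC(2) (`BlobDec2.decAt_all`), the
typer's `decAtT_shift_two` / `decAtT_finite_mixture` (`…QuantDECAtTMixtures`) and `sum_mul_slice` (`…QuantSliceSmallLayers`).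

THE THEOREM (`LawDec.slice_decAtT_of_hdecAtT`).  Floor `0 < x < 1`, blob `(a, g)` with `a ≥ 1`, `x ≤ g ≤ 1`.  If `μ` on `{0..M}` is an exact
mixture of two-point components valid at `(x, T, j′)` by rule (S), rule (G) or the HEAVY case of rule (N) (`g_r ≥ x`, credit
`2lo + (hi−lo)g_r ≥ T`), then `LawDec.slice μ a g` is DEC(j′) at target `T + a·g` on `{0..M+a}`.  Piece by piece
(DEC-CLOSURE-G53 §3.2, now kernel): the slice of `{lo, hi; γ}` is `(1−g)·{lo, hi; γ} + g·{lo+a, hi+a; γ}` (`slice_TP`);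
(S) a self-sufficient point `k` slices to the single component `{k, k+a; g}` — rule (N) with credit `2k + ag ≥ T + ag`, or rule (G) if
`k + a ≥ j′+1`; (G) both shifted copies of a giant-heavy pair are giant-heavy; (heavy N) the slice of `{lo, hi; γ}` is the two-blob law
`LAW2[hi−lo, γ; a, g]` shifted by `lo`, DEC at every layer at its mean `(hi−lo)γ + ag` by BLOB-DEC(2), hence at target
`(hi−lo)γ + ag + 2lo ≥ T + ag` after the shift (DOUBLE bonus `decAtT_shift_two`) — the sure part `lo` counts twice.  LIGHT components are
exactly what this argument cannot do (their two-blob law has a light blob; BLOB-DEC(2) is heavy), and they are where SL's second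
hypothesis (layer `j′ − a`) is consumed (memo §3.2: light pieces fail in isolation iff `hi ∈ (j′−a, j′]`).

COROLLARIES.  `slice_decAt_of_hdecAt` (at the mean: a heavy DEC(j′) datum for `μ` gives DEC(j′) of the slice, no layer-`(j′−a)`
hypothesis); in particular every law certified at layer `j′` by criterion E (`decAt_of_giantsAbsorbLows`: giant pairs + points) or by any
all-heavy flow has DEC slices — the bulk of the SL census (criterion E alone certifies 75–99 % of tree/blob instances, DEC-TAMP-G50 §3.7).
HONEST STATUS: `LawDec.SliceClosed` itself (light components allowed) remains OPEN; nothing here changes a rate or the honest sentence.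

[this work]; DEC rules ARCH-TREES-G49 §2.2 / DEC-TAMP-G50 §3.1, memo DEC-CLOSURE-G53 §3.2 (this lane).  The gluing rows served
[cite: KozmaNitzan2024, Conjecture 3 (p. 15)]; product measure [cite: Grimmett1999, §1.3 p. 10].
-/

noncomputable section

namespace Summit.CriticalPhenomena.PercolationContinuityZ3.Theorems

namespace Quant

open Finset

/-- the two-point law `{lo, hi; g}` (as in `…QuantLawDEC`) -/
local notation3 "TP[" lo ", " hi ", " g ", " h "]" =>
  (g : ℝ) * (if (h : ℕ) = (hi : ℕ) then (1 : ℝ) else 0) + (1 - (g : ℝ)) * (if (h : ℕ) = (lo : ℕ) then (1 : ℝ) else 0)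

/-- the two-blob law `(1−u)(1−v)δ₀ + u(1−v)δ_a + (1−u)vδ_b + uvδ_{a+b}` evaluated at `h` (as in `…QuantBlobDecTwoLawParts`) -/
local notation3 "LAW2[" a ", " u ", " b ", " v ", " h "]" =>
  (1 - (u : ℝ)) * (1 - (v : ℝ)) * (if (h : ℕ) = 0 then (1 : ℝ) else 0)
    + (u : ℝ) * (1 - (v : ℝ)) * (if (h : ℕ) = (a : ℕ) then (1 : ℝ) else 0)
    + (1 - (u : ℝ)) * (v : ℝ) * (if (h : ℕ) = (b : ℕ) then (1 : ℝ) else 0)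
    + (u : ℝ) * (v : ℝ) * (if (h : ℕ) = (a : ℕ) + (b : ℕ) then (1 : ℝ) else 0)

namespace LawDec

/-! ### Heavy validity and heavy DEC -/

/-- **heavy validity**: rule (S), rule (G), or rule (N) with a HEAVY gate (`x ≤ g`, credit `2lo + (hi−lo)·g ≥ T`). [this work] -/
def HValidAt (x T : ℝ) (j' lo hi : ℕ) (g : ℝ) : Prop :=
  (lo = hi ∧ (T ≤ 2 * (lo : ℝ) ∨ j' + 1 ≤ lo)) ∨
  (lo < hi ∧ j' + 1 ≤ hi ∧ x ≤ g) ∨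
  (lo < hi ∧ hi ≤ j' ∧ x ≤ g ∧ T ≤ 2 * (lo : ℝ) + ((hi : ℝ) - lo) * g)

/-- **heavy DEC(j′) at target `T`**: `LawDec.DECAtT` with `HValidAt` in place of `ValidAt` (no light credit pairs). [this work] -/
def HDECAtT (x T : ℝ) (j' M : ℕ) (μ : ℕ → ℝ) : Prop :=
  ∃ (ρ : Type) (_ : Fintype ρ) (lam g : ρ → ℝ) (lo hi : ρ → ℕ),
    (∀ r, 0 ≤ lam r) ∧ (∑ r, lam r = 1) ∧ (∀ r, 0 ≤ g r ∧ g r ≤ 1) ∧ (∀ r, lo r ≤ hi r) ∧ (∀ r, hi r ≤ M) ∧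
    (∀ h, μ h = ∑ r, lam r * TP[lo r, hi r, g r, h]) ∧
    (∀ r, 0 < lam r → HValidAt x T j' (lo r) (hi r) (g r))

/-- heavy validity is validity. [this work] -/
theorem HValidAt.validAt {x T : ℝ} {j' lo hi : ℕ} {g : ℝ} (h : HValidAt x T j' lo hi g) : ValidAt x T j' lo hi g := by
  rcases h with hS | hG | ⟨hlt, hhi, hxg, hcr⟩
  · exact Or.inl hS
  · exact Or.inr (Or.inl hG)
  · refine Or.inr (Or.inr ⟨hlt, hhi, ?_⟩)
    rw [if_pos hxg]; exact hcr

/-- heavy DEC is DEC. [this work] -/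
theorem HDECAtT.decAtT {x T : ℝ} {j' M : ℕ} {μ : ℕ → ℝ} (h : HDECAtT x T j' M μ) : DECAtT x T j' M μ := by
  obtain ⟨ρ, hρ, lam, g, lo, hi, h0, h1, hg, hlohi, hhi, hμ, hval⟩ := h
  exact ⟨ρ, hρ, lam, g, lo, hi, h0, h1, hg, hlohi, hhi, hμ, fun r hr => (hval r hr).validAt⟩

/-! ### Pieces -/

/-- a single valid component is a DEC datum. [this work] -/
theorem decAtT_single (x T : ℝ) (j' M lo hi : ℕ) (γ : ℝ) (hγ : 0 ≤ γ ∧ γ ≤ 1) (hlohi : lo ≤ hi) (hhi : hi ≤ M)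
    (hval : ValidAt x T j' lo hi γ) : DECAtT x T j' M (fun h => TP[lo, hi, γ, h]) :=
  ⟨Unit, inferInstance, fun _ => 1, fun _ => γ, fun _ => lo, fun _ => hi, fun _ => zero_le_one, by simp, fun _ => hγ,
    fun _ => hlohi, fun _ => hhi, fun h => by simp, fun _ _ => hval⟩

/-- **the slice of a two-point component is the `g`-mixture of the component and its copy shifted by `a`.** [this work] -/
theorem slice_TP (lo hi a : ℕ) (γ g : ℝ) (h : ℕ) :
    slice (fun t => TP[lo, hi, γ, t]) a g h = (1 - g) * TP[lo, hi, γ, h] + g * TP[lo + a, hi + a, γ, h] := by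
  simp only [slice]
  congr 1
  by_cases ha : a ≤ h
  · rw [if_pos ha]
    have e1 : (h - a = hi) ↔ (h = hi + a) := by omega
    have e2 : (h - a = lo) ↔ (h = lo + a) := by omega
    simp only [e1, e2]
  · rw [if_neg ha, if_neg (by omega), if_neg (by omega)]
    ring

/-- **(S)-piece**: a self-sufficient point `k` (`T ≤ 2k` or `k ≥ j′+1`) slices to the single component `{k, k+a; g}`, valid at
target `T + a·g` (rule (N) with credit `2k + ag`, or rule (G) when `k + a ≥ j′+1`). [this work] -/
theorem slice_point_decAtT (x T g γ : ℝ) (j' M k a : ℕ) (hxg : x ≤ g) (hg0 : 0 ≤ g) (hg1 : g ≤ 1) (ha : 1 ≤ a) (hkM : k ≤ M)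
    (hS : T ≤ 2 * (k : ℝ) ∨ j' + 1 ≤ k) :
    DECAtT x (T + (a : ℝ) * g) j' (M + a) (slice (fun t => TP[k, k, γ, t]) a g) := by
  have e : slice (fun t => TP[k, k, γ, t]) a g = fun h => TP[k, k + a, g, h] := by
    funext h
    rw [slice_TP]
    ring
  rw [e]
  refine decAtT_single x _ j' (M + a) k (k + a) g ⟨hg0, hg1⟩ (by omega) (by omega) ?_
  by_cases hj : j' + 1 ≤ k + a
  · exact Or.inr (Or.inl ⟨by omega, hj, hxg⟩)
  · refine Or.inr (Or.inr ⟨by omega, by omega, ?_⟩)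
    rw [if_pos hxg]
    rcases hS with h2 | h2
    · push_cast; nlinarith
    · omega

/-- **(G)-piece**: both shifted copies of a giant-heavy pair are giant-heavy (valid at any target). [this work] -/
theorem slice_giant_decAtT (x T' g γ : ℝ) (j' M lo hi a : ℕ) (hg0 : 0 ≤ g) (hg1 : g ≤ 1) (hγ : 0 ≤ γ ∧ γ ≤ 1)
    (hlt : lo < hi) (hhi : hi ≤ M) (hj : j' + 1 ≤ hi) (hxγ : x ≤ γ) :
    DECAtT x T' j' (M + a) (slice (fun t => TP[lo, hi, γ, t]) a g) := by
  have h₁ : DECAtT x T' j' (M + a) (fun h => TP[lo, hi, γ, h]) :=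
    decAtT_single x T' j' (M + a) lo hi γ hγ hlt.le (by omega) (Or.inr (Or.inl ⟨hlt, hj, hxγ⟩))
  have h₂ : DECAtT x T' j' (M + a) (fun h => TP[lo + a, hi + a, γ, h]) :=
    decAtT_single x T' j' (M + a) (lo + a) (hi + a) γ hγ (by omega) (by omega) (Or.inr (Or.inl ⟨by omega, by omega, hxγ⟩))
  have := decAtT_mixture (1 - g) (by linarith) (by linarith) h₁ h₂
  have e : slice (fun t => TP[lo, hi, γ, t]) a g = fun h => (1 - g) * TP[lo, hi, γ, h] + (1 - (1 - g)) * TP[lo + a, hi + a, γ, h] := by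
    funext h; rw [slice_TP, sub_sub_cancel]
  rw [e]; exact this

/-- **(heavy N)-piece**: the slice of a heavy credit pair `{lo, hi; γ}` (`lo < hi ≤ j′`, `x ≤ γ`) is the two-blob law
`LAW2[hi−lo, γ; a, g]` shifted by `lo`; BLOB-DEC(2) at its mean + the double shift bonus give DEC(j′) at every target
`T' ≤ 2lo + (hi−lo)γ + a·g`. [this work] -/
theorem slice_heavyPair_decAtT (x T' g γ : ℝ) (j' M lo hi a : ℕ) (hx0 : 0 < x) (hx1 : x < 1) (hxg : x ≤ g) (hg1 : g ≤ 1)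
    (hxγ : x ≤ γ) (hγ1 : γ ≤ 1) (ha : 1 ≤ a) (hlt : lo < hi) (hhij : hi ≤ j') (hhi : hi ≤ M)
    (hT' : T' ≤ 2 * (lo : ℝ) + ((hi : ℝ) - lo) * γ + (a : ℝ) * g) :
    DECAtT x T' j' (M + a) (slice (fun t => TP[lo, hi, γ, t]) a g) := by
  classical
  obtain ⟨b, hb⟩ : ∃ b, hi = lo + b := ⟨hi - lo, by omega⟩
  have hb0 : 0 < b := by omega
  -- BLOB-DEC(2) for the blobs (b, γ), (a, g) at floor x, every layer
  have hdec := BlobDec2.decAt_all b a (j' - lo) γ g x hb0 (by omega) hx0 hx1 hxγ hγ1 hxg hg1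
  rw [decAt_iff_decAtT, BlobDec2.law_mean] at hdec
  -- shift by lo (double bonus), raise the top, lower the target
  have hsh := decAtT_shift_two x ((b : ℝ) * γ + (a : ℝ) * g) (j' - lo) (b + a) lo _ hdec
  have hlay : j' - lo + lo = j' := by omega
  rw [hlay] at hsh
  have htop : b + a + lo ≤ M + a := by omega
  have hsh' := decAtT_mono_top hsh htop
  have htar : T' ≤ (b : ℝ) * γ + (a : ℝ) * g + 2 * (lo : ℝ) := by
    have : ((hi : ℝ) - lo) = b := by rw [hb]; push_cast; ring
    rw [this] at hT'; linarith
  have hfin := decAtT_antitone_target htar hsh'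
  -- identify the shifted two-blob law with the slice
  have e : (fun h => if lo ≤ h then (fun h => LAW2[b, γ, a, g, h]) (h - lo) else 0) = slice (fun t => TP[lo, hi, γ, t]) a g := by
    funext h
    rw [slice_TP]
    beta_reduce
    by_cases hlo : lo ≤ h
    · rw [if_pos hlo]
      have e0 : (h - lo = 0) ↔ (h = lo) := by omega
      have e1 : (h - lo = b) ↔ (h = hi) := by omega
      have e2 : (h - lo = a) ↔ (h = lo + a) := by omega
      have e3 : (h - lo = b + a) ↔ (h = hi + a) := by omega
      simp only [e0, e1, e2, e3]
      ring
    · rw [if_neg hlo, if_neg (by omega), if_neg (by omega), if_neg (by omega), if_neg (by omega)]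
      ring
  rw [e] at hfin
  exact hfin

/-! ### The theorem -/

/-- **SL FOR HEAVY DECOMPOSITIONS, AT THE CREDIT TARGET.**  Floor `0 < x < 1`, blob `(a, g)` with `a ≥ 1`, `x ≤ g ≤ 1`: if `μ` on
`{0..M}` is heavy-DEC(j′) at target `T` (`LawDec.HDECAtT`), then `LawDec.slice μ a g` is DEC(j′) at target `T + a·g` on `{0..M+a}`
(`Quant.LawDec.DECAtT`).  One hypothesis, one layer. [this work] -/
theorem slice_decAtT_of_hdecAtT (x T g : ℝ) (j' M a : ℕ) (μ : ℕ → ℝ) (hx0 : 0 < x) (hx1 : x < 1) (hxg : x ≤ g) (hg1 : g ≤ 1)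
    (ha : 1 ≤ a) (h : HDECAtT x T j' M μ) : DECAtT x (T + (a : ℝ) * g) j' (M + a) (slice μ a g) := by
  classical
  obtain ⟨ρ, hρ, lam, gg, lo, hi, h0, h1, hgg, hlohi, hhi, hμ, hval⟩ := h
  have hg0 : 0 ≤ g := hx0.le.trans hxg
  -- the slice is the mixture of the sliced components
  have hmix : ∀ t, slice μ a g t = ∑ r, lam r * slice (fun s => TP[lo r, hi r, gg r, s]) a g t := by
    intro t
    simp only [slice]
    rw [hμ t]
    have e2 : (if a ≤ t then μ (t - a) else 0) = ∑ r, lam r * (if a ≤ t then TP[lo r, hi r, gg r, t - a] else 0) := by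
      split_ifs with hat
      · rw [hμ (t - a)]
      · simp
    rw [e2, Finset.mul_sum, Finset.mul_sum, ← Finset.sum_add_distrib]
    refine Finset.sum_congr rfl fun r _ => ?_
    ring
  refine decAtT_finite_mixture x _ j' (M + a) (slice μ a g) lam (fun r => slice (fun s => TP[lo r, hi r, gg r, s]) a g)
    h0 h1 hmix fun r hr => ?_
  rcases hval r hr with ⟨heq, hS⟩ | ⟨hlt, hj, hxγ⟩ | ⟨hlt, hhij, hxγ, hcr⟩
  · -- (S)-piece
    have e : (fun s => TP[lo r, hi r, gg r, s]) = fun s => TP[lo r, lo r, gg r, s] := by rw [heq]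
    rw [e]
    exact slice_point_decAtT x T g (gg r) j' M (lo r) a hxg hg0 hg1 ha ((hlohi r).trans (hhi r)) hS
  · -- (G)-piece
    exact slice_giant_decAtT x _ g (gg r) j' M (lo r) (hi r) a hg0 hg1 (hgg r) hlt (hhi r) hj hxγ
  · -- heavy (N)-piece
    exact slice_heavyPair_decAtT x _ g (gg r) j' M (lo r) (hi r) a hx0 hx1 hxg hg1 hxγ (hgg r).2 ha hlt hhij (hhi r)
      (by linarith)

/-- **AT THE MEAN.**  For a law `μ` on `{0..M}` (`μ = 0` above `M`, mass `1`) with a HEAVY DEC(j′) datum at its own mean, the slice by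
a blob `(a ≥ 1, x ≤ g ≤ 1)` is DEC(j′) (`Quant.LawDec.DECAt`, i.e. at the slice's mean `T + ag`) — Conjecture SL's conclusion from its
layer-`j′` hypothesis alone, whenever that hypothesis is witnessed without light credit pairs. [this work] -/
theorem slice_decAt_of_hdecAt (x g : ℝ) (j' M a : ℕ) (μ : ℕ → ℝ) (hx0 : 0 < x) (hx1 : x < 1) (hxg : x ≤ g) (hg1 : g ≤ 1)
    (ha : 1 ≤ a) (hμM : ∀ h, M < h → μ h = 0) (hμ1 : ∑ h ∈ Finset.range (M + 1), μ h = 1)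
    (h : HDECAtT x (∑ h ∈ Finset.range (M + 1), (h : ℝ) * μ h) j' M μ) : DECAt x j' (M + a) (slice μ a g) := by
  rw [decAt_iff_decAtT, sum_mul_slice μ a g M hμM hμ1]
  exact slice_decAtT_of_hdecAtT x _ g j' M a μ hx0 hx1 hxg hg1 ha h

end LawDec

end Quant

end Summit.CriticalPhenomena.PercolationContinuityZ3.Theorems
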